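import Literature.Barriers.CriticalPhenomena.RigorousRGSmallParameterDiscreteTaylor
import HarnessLib

/-!
# `RigorousRGSmallParameter` (Slade, Theorem 1.4.1): the discrete Taylor remainder at a general base
# point, its exactness cases and the parametric (frozen-slot) form — [BS-rg-loc] Lemma 3.3.3, steps

Companion ("proof architecture") file of
`Literature/Barriers/CriticalPhenomena/RigorousRGSmallParameter.lean` (Loc norm-estimates layer,
towards [BS-rg-loc] Proposition 1.4.6 / (prop:LTKbound) via Lemma (lem:phij)). [BS-rg-loc]
Lemma 3.3.3: "without loss of generality, we assume that `a = 0` … To advance the induction, we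
assume that (e:Tayrem) holds for `p-1` … and apply the case `p-1` to `g` with the coordinate `z_p`
regarded as a parameter." This file PROVES, on top of `…DiscreteTaylor` (the case `a = 0`):
the remainder `R_s(b;m)g = g(b+m) - Σ_{α≤s}C(m,α)(Δ^αg)(b)` at a base point `b` (reduction by
translation), its bound `|R_s(b;m)g| ≤ C(m,s+1)·sup_{[b,b+m]}|Δ^{s+1}g|`, exactness when
`Δ^{s+1}g = 0` on the range or when `s ≥ m` (Newton's formula at `b`), `C(m,s+1) ≤ m^{s+1}`, and the
parametric form with a frozen parameter. All PROVED, 0 sorry: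

* `taylorRemAt`, `taylorRemAt_eq`, **`abs_taylorRemAt_le`**, `taylorRemAt_eq_zero`,
  `choose_le_pow_div`, **`abs_taylorRemAt_le_param`**, `newton_forward_at`,
  `taylorRemAt_eq_zero_of_le`.

Sources: D. C. Brydges, G. Slade, *A renormalisation group method. II. Approximation by local
polynomials*, J. Stat. Phys. 159 (2015) 461–491, arXiv:1403.7253, Lemma 3.3.3 and its proof
(the quoted sentences), TeX-source numbering.

## References

* [BrydgesSlade2015RGII] D. C. Brydges, G. Slade, *A renormalisation group method. II.
  Approximation by local polynomials*, J. Stat. Phys. **159** (2015) 461–491, arXiv:1403.7253.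
-/

noncomputable section

namespace Literature.Barriers.CriticalPhenomena

namespace LongRangePhi4

namespace Bump

open Finset

/-- The Taylor remainder of order `s` at the base point `b`, `m` steps to the right:
`R_s(b;m)g = g(b+m) - Σ_{α≤s} C(m,α)(Δ^αg)(b)`. [cite: BrydgesSlade2015RGII, Lemma 3.3.3 (remainder at a general a: "without loss of generality, we assume that a = 0")] -/
def taylorRemAt (s : ℕ) (b : ℤ) (m : ℕ) (g : ℤ → ℝ) : ℝ :=
  g (b + m) - ∑ α ∈ range (s + 1), (m.choose α : ℝ) * (fwdDiff^[α] g) b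

/-- Reduction to the base point `0` by translation. [folklore] -/
theorem taylorRemAt_eq (s : ℕ) (b : ℤ) (m : ℕ) (g : ℤ → ℝ) : taylorRemAt s b m g = taylorRem s m (shiftZ b g) := by
  unfold taylorRemAt taylorRem
  simp only [iter_fwdDiff_shiftZ, shiftZ, zero_add, add_comm (m : ℤ) b]

/-- **The remainder bound at a general base point**: `|R_s(b;m)g| ≤ C(m,s+1)·sup_{b≤x≤b+m}|Δ^{s+1}g(x)|`.
[cite: BrydgesSlade2015RGII, Lemma 3.3.3 (display (e:Tayrem))] -/
theorem abs_taylorRemAt_le (s : ℕ) (b : ℤ) (m : ℕ) (g : ℤ → ℝ) (C : ℝ)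
    (hC : ∀ x : ℤ, b ≤ x → x ≤ b + m → |(fwdDiff^[s + 1] g) x| ≤ C) :
    |taylorRemAt s b m g| ≤ (m.choose (s + 1) : ℝ) * C := by
  rw [taylorRemAt_eq]
  refine abs_taylorRem_le s m (shiftZ b g) C fun x h0 hx => ?_
  rw [iter_fwdDiff_shiftZ]
  simp only [shiftZ]
  exact hC (x + b) (by linarith) (by linarith)

/-- The Newton polynomial part is exact when `g` has vanishing `(s+1)`-st differences on the range. [folklore] -/
theorem taylorRemAt_eq_zero (s : ℕ) (b : ℤ) (m : ℕ) (g : ℤ → ℝ)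
    (h0 : ∀ x : ℤ, b ≤ x → x ≤ b + m → (fwdDiff^[s + 1] g) x = 0) : taylorRemAt s b m g = 0 := by
  have h := abs_taylorRemAt_le s b m g 0 fun x h1 h2 => by rw [h0 x h1 h2, abs_zero]
  rw [mul_zero] at h
  exact abs_eq_zero.1 (le_antisymm h (abs_nonneg _))

/-- **Binomial growth of the remainder constant**: `C(m,s+1) ≤ m^{s+1}/(s+1)! ≤ m^{s+1}`. [folklore] -/
theorem choose_le_pow_div (m s : ℕ) : (m.choose (s + 1) : ℝ) ≤ (m : ℝ) ^ (s + 1) := by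
  exact_mod_cast Nat.choose_le_pow m (s + 1)

/-- **Parametric (frozen-slot) form**: for a family `G : ℤ → X → ℝ` whose `(s+1)`-st differences in
the first variable are bounded by `C` uniformly in the parameter on `[b, b+m]`, the remainder is
bounded uniformly: the induction step of Lemma 3.3.3 "with the coordinate `z_p` regarded as a
parameter". [cite: BrydgesSlade2015RGII, Lemma 3.3.3 (proof, induction on p)] -/
theorem abs_taylorRemAt_le_param {X : Type*} (s : ℕ) (b : ℤ) (m : ℕ) (G : ℤ → X → ℝ) (C : ℝ)
    (hC : ∀ (x : ℤ) (ξ : X), b ≤ x → x ≤ b + m → |(fwdDiff^[s + 1] (fun t => G t ξ)) x| ≤ C) (ξ : X) :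
    |taylorRemAt s b m (fun t => G t ξ)| ≤ (m.choose (s + 1) : ℝ) * C :=
  abs_taylorRemAt_le s b m _ C fun x h1 h2 => hC x ξ h1 h2

/-- **Newton's formula at a base point** (exact, all orders): `g(b+m) = Σ_{α≤m} C(m,α)(Δ^αg)(b)`. [folklore] -/
theorem newton_forward_at (g : ℤ → ℝ) (b : ℤ) (m : ℕ) :
    g (b + m) = ∑ α ∈ range (m + 1), (m.choose α : ℝ) * (fwdDiff^[α] g) b :=
  newton_forward g m b

/-- The remainder vanishes identically once `s ≥ m` (the Newton formula is then exact). [folklore] -/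
theorem taylorRemAt_eq_zero_of_le (s : ℕ) (b : ℤ) (m : ℕ) (g : ℤ → ℝ) (hms : m ≤ s) : taylorRemAt s b m g = 0 := by
  unfold taylorRemAt
  rw [newton_forward_at g b m]
  rw [← Finset.sum_range_add_sum_Ico _ (show m + 1 ≤ s + 1 by omega)]
  have hz : ∑ α ∈ Finset.Ico (m + 1) (s + 1), (m.choose α : ℝ) * (fwdDiff^[α] g) b = 0 := by
    refine Finset.sum_eq_zero fun α hα => ?_
    rw [Finset.mem_Ico] at hα
    rw [Nat.choose_eq_zero_of_lt (by omega)]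
    simp
  rw [hz, add_zero, sub_self]

end Bump

end LongRangePhi4

end Literature.Barriers.CriticalPhenomena
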